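import Literature.Analysis.SpecialFunctions.GammaVerticalBounds
import Mathlib.Analysis.SpecialFunctions.Gamma.BohrMollerup
import HarnessLib

/-!
# Two-sided bounds of Stirling order for `|Γ(x + iy)|` on `0 < x ≤ 5/2`

Topic `Literature/Analysis/SpecialFunctions`, a complement to `GammaVerticalBounds.lean`
(`Literature.Analysis.SpecialFunctions.GammaVert.norm_Gamma_mul_norm_cos_le`, the upper bound
`‖Γ(x+iy)‖‖cos(π(x+iy)/2)‖ ≤ 4π²(1+|y|)^{x−1/2}` on `1/2 ≤ x ≤ 1`, obtained there from the
log-convexity of `x ↦ Γ(x)²/‖Γ(x+iy)‖²` and the exact values at `x = 1, 3/2`). Everything here is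
PROVED; there are no named facts and no definitions.

Stirling's formula gives `|Γ(x + iy)| ~ √(2π) |y|^{x − 1/2} e^{−π|y|/2}` uniformly for `x` in a
compact set (Titchmarsh, *The Theory of the Riemann Zeta-Function*, (4.12.2); Whittaker–Watson
§13.6). Mathlib has no complex Stirling formula; this file proves the elementary two-sided
substitute with the correct exponential factor `e^{−π|y|/2}` and crude polynomial factors, which is
all that is needed when the quantities compared differ by a factor `e^{c|y|}`:

* `Literature.Analysis.SpecialFunctions.norm_Gamma_ge_Gamma_mul_exp` — **lower bound**
  `‖Γ(x + iy)‖ ≥ Γ(x) e^{−π|y|/2}` for `1/2 ≤ x ≤ 3/2` (the *other* secant of the same convexity: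
  `log(Γ(x)²/‖Γ(x+iy)‖²) ≤ max` of its values at `x = 1/2` (`log cosh πy`) and `x = 3/2`
  (`log(cosh(πy)/(1 + 4y²))`), both `≤ π|y|`);
* `Literature.Analysis.SpecialFunctions.norm_Gamma_ge_exp` — `‖Γ(x + iy)‖ ≥ (2/15) e^{−π|y|/2}` for
  `1/2 ≤ x ≤ 5/2` (with `Γ(x) ≥ 4/15` on `[1/2, 3/2]` and the recurrence);
* `Literature.Analysis.SpecialFunctions.norm_Gamma_le_exp` — **upper bound**
  `‖Γ(x + iy)‖ ≤ 16π² (1 + |y|)^{1/2} e^{−π|y|/2}` for `0 < x ≤ 1`, `|y| ≥ 1` (from the tree's bound and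
  `‖cos(π(x+iy)/2)‖ ≥ |sinh(πy/2)| ≥ e^{π|y|/2}/4` on `1/2 ≤ x ≤ 1`, and by the reflection formula
  `Γ(z)Γ(1−z) = π/sin πz`, `‖sin πz‖ ≥ |sinh πy|`, on `0 < x < 1/2`);
* `Literature.Analysis.SpecialFunctions.norm_Gamma_le_exp_of_le_two` — the same with exponent `3/2`
  in the polynomial factor, on `0 < x ≤ 2` (recurrence).

## References

* E. C. Titchmarsh, *The Theory of the Riemann Zeta-Function*, 2nd ed. (1986), §4.12, (4.12.2).
* E. T. Whittaker, G. N. Watson, *A Course of Modern Analysis*, 4th ed., §12.14, §13.6.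
-/

noncomputable section

open Real Set Complex

namespace Literature.Analysis.SpecialFunctions

open GammaVert

/-! ### Real `Γ`: `Γ ≥ 1` on `[2, ∞)` and `Γ ≥ 4/15` on `[1/2, 3/2]` -/

/-- `Γ(y) ≥ 1` for `y ≥ 2` (convexity of `Γ` on `(0, ∞)` and `Γ(1) = Γ(2) = 1`). [folklore] -/
theorem one_le_Gamma_of_two_le {y : ℝ} (hy : 2 ≤ y) : 1 ≤ Real.Gamma y := by
  rcases eq_or_lt_of_le hy with h | h
  · rw [← h, Real.Gamma_two]
  have hc := Real.convexOn_Gamma.slope_mono_adjacent (x := 1) (y := 2) (z := y)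
    (by norm_num) (by simp; linarith) (by norm_num) h
  rw [Real.Gamma_two, Real.Gamma_one] at hc
  norm_num at hc
  rw [le_div_iff₀ (by linarith)] at hc
  linarith

/-- `Γ(x) ≥ 4/15` for `1/2 ≤ x ≤ 3/2` (`Γ(x) = Γ(x+2)/(x(x+1)) ≥ 1/(x(x+1))`). [folklore] -/
theorem Gamma_ge_four_div_fifteen {x : ℝ} (h1 : 1 / 2 ≤ x) (h2 : x ≤ 3 / 2) :
    4 / 15 ≤ Real.Gamma x := by
  have hx0 : 0 < x := by linarith
  have e1 : Real.Gamma (x + 1) = x * Real.Gamma x := Real.Gamma_add_one hx0.ne'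
  have e2 : Real.Gamma (x + 1 + 1) = (x + 1) * Real.Gamma (x + 1) := Real.Gamma_add_one (by linarith)
  have hge : 1 ≤ Real.Gamma (x + 1 + 1) := one_le_Gamma_of_two_le (by linarith)
  rw [e2, e1] at hge
  have hG := Real.Gamma_pos_of_pos hx0
  have : (x + 1) * x ≤ 15 / 4 := by nlinarith
  nlinarith

/-! ### Hyperbolic bounds for `|cos z|`, `|sin z|` -/

/-- `e^u ≤ 4 sinh u` for `u ≥ 1/2` (`e^{2u} ≥ e ≥ 2`). [folklore] -/
theorem exp_le_four_mul_sinh {u : ℝ} (hu : 1 / 2 ≤ u) : Real.exp u ≤ 4 * Real.sinh u := by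
  rw [Real.sinh_eq]
  have hpos := Real.exp_pos u
  have hprod : Real.exp (-u) * Real.exp u = 1 := by rw [← Real.exp_add]; simp
  have h2 : 2 ≤ Real.exp u * Real.exp u := by
    rw [← Real.exp_add]
    have : Real.exp 1 ≤ Real.exp (u + u) := Real.exp_le_exp.2 (by linarith)
    linarith [Real.exp_one_gt_d9]
  nlinarith [Real.exp_pos (-u)]

/-- `|sinh(Im z)| ≤ ‖cos z‖` (`‖cos(a+ib)‖² = cos²a + sinh²b`). [folklore] -/
theorem abs_sinh_im_le_norm_cos (z : ℂ) : |Real.sinh z.im| ≤ ‖Complex.cos z‖ := by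
  have h : Complex.cos z = ((Real.cos z.re * Real.cosh z.im : ℝ) : ℂ) +
      ((-(Real.sin z.re * Real.sinh z.im) : ℝ) : ℂ) * I := by
    rw [Complex.cos_eq]
    push_cast
    ring
  have hre : (Complex.cos z).re = Real.cos z.re * Real.cosh z.im := by
    rw [h]
    simp only [Complex.add_re, Complex.mul_re, Complex.ofReal_re, Complex.ofReal_im, Complex.I_re,
      Complex.I_im]
    ring
  have him : (Complex.cos z).im = -(Real.sin z.re * Real.sinh z.im) := by
    rw [h]
    simp only [Complex.add_im, Complex.mul_im, Complex.ofReal_re, Complex.ofReal_im, Complex.I_re,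
      Complex.I_im]
    ring
  have hsq : ‖Complex.cos z‖ ^ 2 = (Real.cos z.re * Real.cosh z.im) ^ 2 +
      (Real.sin z.re * Real.sinh z.im) ^ 2 := by
    rw [Complex.sq_norm, Complex.normSq_apply, hre, him]; ring
  have hge : Real.sinh z.im ^ 2 ≤ ‖Complex.cos z‖ ^ 2 := by
    rw [hsq]
    have h1 := Real.cos_sq_add_sin_sq z.re
    have h2 : Real.cosh z.im ^ 2 = Real.sinh z.im ^ 2 + 1 := by
      rw [Real.cosh_sq z.im]
    nlinarith [sq_nonneg (Real.cos z.re), sq_nonneg (Real.sin z.re), sq_nonneg (Real.sinh z.im)]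
  exact abs_le.2 (abs_le_of_sq_le_sq' hge (norm_nonneg _))

/-- `|sinh(Im z)| ≤ ‖sin z‖` (`‖sin(a+ib)‖² = sin²a + sinh²b`). [folklore] -/
theorem abs_sinh_im_le_norm_sin (z : ℂ) : |Real.sinh z.im| ≤ ‖Complex.sin z‖ := by
  have h : Complex.sin z = ((Real.sin z.re * Real.cosh z.im : ℝ) : ℂ) +
      ((Real.cos z.re * Real.sinh z.im : ℝ) : ℂ) * I := by
    rw [Complex.sin_eq]
    push_cast
    ring
  have hre : (Complex.sin z).re = Real.sin z.re * Real.cosh z.im := by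
    rw [h]
    simp only [Complex.add_re, Complex.mul_re, Complex.ofReal_re, Complex.ofReal_im, Complex.I_re,
      Complex.I_im]
    ring
  have him : (Complex.sin z).im = Real.cos z.re * Real.sinh z.im := by
    rw [h]
    simp only [Complex.add_im, Complex.mul_im, Complex.ofReal_re, Complex.ofReal_im, Complex.I_re,
      Complex.I_im]
    ring
  have hsq : ‖Complex.sin z‖ ^ 2 = (Real.sin z.re * Real.cosh z.im) ^ 2 +
      (Real.cos z.re * Real.sinh z.im) ^ 2 := by
    rw [Complex.sq_norm, Complex.normSq_apply, hre, him]; ring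
  have hge : Real.sinh z.im ^ 2 ≤ ‖Complex.sin z‖ ^ 2 := by
    rw [hsq]
    have h1 := Real.cos_sq_add_sin_sq z.re
    have h2 : Real.cosh z.im ^ 2 = Real.sinh z.im ^ 2 + 1 := by
      rw [Real.cosh_sq z.im]
    nlinarith [sq_nonneg (Real.cos z.re), sq_nonneg (Real.sin z.re), sq_nonneg (Real.sinh z.im)]
  exact abs_le.2 (abs_le_of_sq_le_sq' hge (norm_nonneg _))

/-! ### The lower bound `‖Γ(x + iy)‖ ≥ Γ(x) e^{−π|y|/2}` on `1/2 ≤ x ≤ 3/2` -/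

/-- The log-convex function `L_y(x) = log(Γ(x)²/‖Γ(x+iy)‖²)` at the node `x = 1/2` equals
`log cosh(πy) ≤ π|y|`. [folklore] -/
theorem log_gammaRatio_half_le (y : ℝ) :
    Real.log (Real.Gamma (1 / 2) ^ 2 / ‖Complex.Gamma ((1 / 2 : ℝ) + y * I)‖ ^ 2) ≤ π * |y| := by
  have h : ‖Complex.Gamma ((1 / 2 : ℝ) + y * I)‖ ^ 2 = π / Real.cosh (π * y) := by
    have := norm_sq_Gamma_half y
    push_cast at this ⊢
    exact this
  have hc : 0 < Real.cosh (π * y) := Real.cosh_pos _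
  have e : Real.Gamma (1 / 2) ^ 2 / ‖Complex.Gamma ((1 / 2 : ℝ) + y * I)‖ ^ 2 = Real.cosh (π * y) := by
    rw [h, Real_Gamma_half_sq]
    field_simp
  rw [e]
  have hcosh : Real.cosh (π * y) ≤ Real.exp |π * y| := by
    rw [Real.cosh_eq]
    have h1 : Real.exp (π * y) ≤ Real.exp |π * y| := Real.exp_le_exp.2 (le_abs_self _)
    have h2 : Real.exp (-(π * y)) ≤ Real.exp |π * y| := Real.exp_le_exp.2 (neg_le_abs _)
    linarith
  calc Real.log (Real.cosh (π * y)) ≤ Real.log (Real.exp |π * y|) :=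
        Real.log_le_log hc hcosh
    _ = π * |y| := by rw [Real.log_exp, abs_mul, abs_of_pos Real.pi_pos]

/-- The node `x = 3/2`: `L_y(3/2) = log(cosh(πy)/(1 + 4y²)) ≤ π|y|`. [folklore] -/
theorem log_gammaRatio_three_halves_le (y : ℝ) :
    Real.log (Real.Gamma (3 / 2) ^ 2 / ‖Complex.Gamma ((3 / 2 : ℝ) + y * I)‖ ^ 2) ≤ π * |y| := by
  have h : ‖Complex.Gamma ((3 / 2 : ℝ) + y * I)‖ ^ 2 = (1 / 4 + y ^ 2) * (π / Real.cosh (π * y)) := by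
    have := norm_sq_Gamma_three_halves y
    push_cast at this ⊢
    exact this
  have hc : 0 < Real.cosh (π * y) := Real.cosh_pos _
  have hπ := Real.pi_pos
  have e : Real.Gamma (3 / 2) ^ 2 / ‖Complex.Gamma ((3 / 2 : ℝ) + y * I)‖ ^ 2 =
      Real.cosh (π * y) / (1 + 4 * y ^ 2) := by
    rw [h, Real_Gamma_three_halves_sq]
    field_simp
  rw [e]
  have hle : Real.cosh (π * y) / (1 + 4 * y ^ 2) ≤ Real.cosh (π * y) :=
    div_le_self hc.le (by nlinarith)
  have hcosh : Real.cosh (π * y) ≤ Real.exp |π * y| := by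
    rw [Real.cosh_eq]
    have h1 : Real.exp (π * y) ≤ Real.exp |π * y| := Real.exp_le_exp.2 (le_abs_self _)
    have h2 : Real.exp (-(π * y)) ≤ Real.exp |π * y| := Real.exp_le_exp.2 (neg_le_abs _)
    linarith
  calc Real.log (Real.cosh (π * y) / (1 + 4 * y ^ 2)) ≤ Real.log (Real.exp |π * y|) :=
        Real.log_le_log (by positivity) (hle.trans hcosh)
    _ = π * |y| := by rw [Real.log_exp, abs_mul, abs_of_pos Real.pi_pos]

/-- `L_y(x) = log(Γ(x)²/‖Γ(x+iy)‖²) ≤ π|y|` for `1/2 ≤ x ≤ 3/2` (log-convexity,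
`Literature.Analysis.SpecialFunctions.GammaVert.slope_log_gammaRatio_mono`, and the two nodes). [folklore] -/
theorem log_gammaRatio_le {x : ℝ} (h1 : 1 / 2 ≤ x) (h2 : x ≤ 3 / 2) (y : ℝ) :
    Real.log (Real.Gamma x ^ 2 / ‖Complex.Gamma (x + y * I)‖ ^ 2) ≤ π * |y| := by
  rcases eq_or_lt_of_le h1 with h | hlt
  · rw [← h]; exact_mod_cast log_gammaRatio_half_le y
  rcases eq_or_lt_of_le h2 with h' | hlt'
  · rw [h']; exact_mod_cast log_gammaRatio_three_halves_le y
  have hs := slope_log_gammaRatio_mono y (a := 1 / 2) (b := x) (c := 3 / 2) (by norm_num) hlt hlt'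
  have hA := log_gammaRatio_half_le y
  have hB := log_gammaRatio_three_halves_le y
  set L := Real.log (Real.Gamma x ^ 2 / ‖Complex.Gamma (x + y * I)‖ ^ 2) with hL
  set L₁ := Real.log (Real.Gamma (1 / 2) ^ 2 / ‖Complex.Gamma ((1 / 2 : ℝ) + y * I)‖ ^ 2) with hL₁
  set L₂ := Real.log (Real.Gamma (3 / 2) ^ 2 / ‖Complex.Gamma ((3 / 2 : ℝ) + y * I)‖ ^ 2) with hL₂
  rw [div_le_div_iff₀ (by linarith) (by linarith)] at hs
  nlinarith

/-- **Lower bound of Stirling order**: `Γ(x) e^{−π|y|/2} ≤ ‖Γ(x + iy)‖` for `1/2 ≤ x ≤ 3/2` and all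
real `y` (Stirling: `‖Γ(x+iy)‖ ~ √(2π)|y|^{x−1/2}e^{−π|y|/2}`). [cite: Titchmarsh1986, §4.12 (4.12.2), consequence] -/
theorem norm_Gamma_ge_Gamma_mul_exp {x : ℝ} (h1 : 1 / 2 ≤ x) (h2 : x ≤ 3 / 2) (y : ℝ) :
    Real.Gamma x * Real.exp (-(π * |y|) / 2) ≤ ‖Complex.Gamma (x + y * I)‖ := by
  have hx0 : 0 < x := by linarith
  have hG : 0 < Real.Gamma x := Real.Gamma_pos_of_pos hx0
  have hn : 0 < ‖Complex.Gamma (x + y * I)‖ := norm_pos_iff.2 (Gamma_ne_zero_of_pos hx0 y)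
  have hlog := log_gammaRatio_le h1 h2 y
  rw [Real.log_le_iff_le_exp (by positivity), div_le_iff₀ (by positivity)] at hlog
  -- `Γ(x)² ≤ e^{π|y|} ‖Γ‖²`, i.e. `(Γ(x) e^{-π|y|/2})² ≤ ‖Γ‖²`
  have hsq : (Real.Gamma x * Real.exp (-(π * |y|) / 2)) ^ 2 ≤ ‖Complex.Gamma (x + y * I)‖ ^ 2 := by
    have e : Real.exp (-(π * |y|) / 2) ^ 2 = (Real.exp (π * |y|))⁻¹ := by
      rw [← Real.exp_nat_mul, ← Real.exp_neg]; congr 1; push_cast; ring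
    rw [mul_pow, e]
    rw [mul_inv_le_iff₀ (Real.exp_pos _), mul_comm]
    exact hlog
  exact le_of_pow_le_pow_left₀ two_ne_zero hn.le hsq

/-- **Uniform lower bound `‖Γ(x + iy)‖ ≥ (2/15) e^{−π|y|/2}` for `1/2 ≤ x ≤ 5/2`** (all real `y`):
`Γ(x) ≥ 4/15` on `[1/2, 3/2]`, and `Γ(z+1) = zΓ(z)` with `|z| ≥ Re z ≥ 1/2` beyond. [folklore] -/
theorem norm_Gamma_ge_exp {x : ℝ} (h1 : 1 / 2 ≤ x) (h2 : x ≤ 5 / 2) (y : ℝ) :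
    2 / 15 * Real.exp (-(π * |y|) / 2) ≤ ‖Complex.Gamma (x + y * I)‖ := by
  have hE := Real.exp_pos (-(π * |y|) / 2)
  rcases le_or_gt x (3 / 2) with h | h
  · have := norm_Gamma_ge_Gamma_mul_exp h1 h y
    have hG := Gamma_ge_four_div_fifteen h1 h
    nlinarith
  · -- recurrence from `x - 1 ∈ (1/2, 3/2]`
    have hz : ((x - 1 : ℝ) : ℂ) + y * I ≠ 0 := by
      intro h0; have := congrArg Complex.re h0; simp at this; linarith
    have hrec : Complex.Gamma (x + y * I) = (((x - 1 : ℝ) : ℂ) + y * I) *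
        Complex.Gamma (((x - 1 : ℝ) : ℂ) + y * I) := by
      have e : ((x - 1 : ℝ) : ℂ) + y * I + 1 = x + y * I := by
        rw [Complex.ofReal_sub, Complex.ofReal_one]; ring
      rw [← e]; exact Complex.Gamma_add_one _ hz
    have hlow := norm_Gamma_ge_Gamma_mul_exp (x := x - 1) (by linarith) (by linarith) y
    have hG := Gamma_ge_four_div_fifteen (x := x - 1) (by linarith) (by linarith)
    have hmod : x - 1 ≤ ‖((x - 1 : ℝ) : ℂ) + y * I‖ := by
      have := Complex.re_le_norm (((x - 1 : ℝ) : ℂ) + y * I)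
      simpa using this
    rw [hrec, norm_mul]
    have hx1 : 1 / 2 ≤ x - 1 := by linarith
    calc 2 / 15 * Real.exp (-(π * |y|) / 2) ≤ (1 / 2) * (4 / 15 * Real.exp (-(π * |y|) / 2)) := by
          nlinarith
      _ ≤ ‖((x - 1 : ℝ) : ℂ) + y * I‖ * (Real.Gamma (x - 1) * Real.exp (-(π * |y|) / 2)) := by
          apply mul_le_mul (hx1.trans hmod) (by nlinarith) (by positivity) (norm_nonneg _)
      _ ≤ ‖((x - 1 : ℝ) : ℂ) + y * I‖ * ‖Complex.Gamma (((x - 1 : ℝ) : ℂ) + y * I)‖ :=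
          mul_le_mul_of_nonneg_left hlow (norm_nonneg _)

/-! ### The upper bound `‖Γ(x + iy)‖ ≤ 16π² (1 + |y|)^{1/2} e^{−π|y|/2}` on `0 < x ≤ 1`, `|y| ≥ 1` -/

/-- On `1/2 ≤ x ≤ 1`, `|y| ≥ 1`: `‖Γ(x+iy)‖ ≤ 16π²(1+|y|)^{x−1/2}e^{−π|y|/2}` (the tree's
`‖Γ‖‖cos(π(x+iy)/2)‖ ≤ 4π²(1+|y|)^{x−1/2}` and `‖cos(π(x+iy)/2)‖ ≥ sinh(π|y|/2) ≥ e^{π|y|/2}/4`).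
[cite: Titchmarsh1986, §4.12 (4.12.2), consequence] -/
theorem norm_Gamma_le_exp_of_half_le {x y : ℝ} (h1 : 1 / 2 ≤ x) (h2 : x ≤ 1) (hy : 1 ≤ |y|) :
    ‖Complex.Gamma (x + y * I)‖ ≤ 16 * π ^ 2 * (1 + |y|) ^ (x - 1 / 2) * Real.exp (-(π * |y|) / 2) := by
  have hmain := norm_Gamma_mul_norm_cos_le h1 h2 y
  have hπ := Real.pi_pos
  have hπ3 := Real.pi_gt_three
  -- lower bound for the cosine factor
  set c := ‖Complex.cos (π * (x + y * I) / 2)‖ with hc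
  have him : (π * ((x : ℂ) + y * I) / 2).im = π * y / 2 := by
    simp
  have hcos : Real.exp (π * |y| / 2) / 4 ≤ c := by
    have h := abs_sinh_im_le_norm_cos (π * (x + y * I) / 2)
    rw [him, Real.abs_sinh, show |π * y / 2| = π * |y| / 2 by
      rw [abs_div, abs_mul, abs_of_pos hπ, abs_two]] at h
    have hs := exp_le_four_mul_sinh (u := π * |y| / 2) (by nlinarith)
    rw [hc]
    linarith
  have hc0 : 0 < c := lt_of_lt_of_le (by positivity) hcos
  have hE : Real.exp (π * |y| / 2) * Real.exp (-(π * |y|) / 2) = 1 := by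
    rw [← Real.exp_add]; convert Real.exp_zero using 2; ring
  -- `‖Γ‖ ≤ 4π²(1+|y|)^{x-1/2} / c ≤ 4π²(1+|y|)^{x-1/2} · 4 e^{-π|y|/2}`
  have h1' : ‖Complex.Gamma (x + y * I)‖ ≤ 4 * π ^ 2 * (1 + |y|) ^ (x - 1 / 2) / c := by
    rw [le_div_iff₀ hc0]; exact hmain
  refine h1'.trans ?_
  rw [div_le_iff₀ hc0]
  have hP : 0 ≤ 4 * π ^ 2 * (1 + |y|) ^ (x - 1 / 2) := by positivity
  calc 4 * π ^ 2 * (1 + |y|) ^ (x - 1 / 2) = 4 * π ^ 2 * (1 + |y|) ^ (x - 1 / 2) *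
        (Real.exp (-(π * |y|) / 2) * Real.exp (π * |y| / 2)) := by rw [mul_comm (Real.exp _), hE, mul_one]
    _ = 16 * π ^ 2 * (1 + |y|) ^ (x - 1 / 2) * Real.exp (-(π * |y|) / 2) *
        (Real.exp (π * |y| / 2) / 4) := by ring
    _ ≤ 16 * π ^ 2 * (1 + |y|) ^ (x - 1 / 2) * Real.exp (-(π * |y|) / 2) * c := by
        gcongr

/-- **Upper bound of Stirling order**: `‖Γ(x + iy)‖ ≤ 16π² (1+|y|)^{1/2} e^{−π|y|/2}` for `0 < x ≤ 1`,
`|y| ≥ 1`. On `0 < x < 1/2` this uses the reflection formula `Γ(z)Γ(1−z) = π/sin(πz)` with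
`‖sin πz‖ ≥ sinh(π|y|) ≥ e^{π|y|}/4` and the lower bound for `‖Γ(1 − z)‖`, giving `≤ 15π e^{−π|y|/2}`.
[cite: Titchmarsh1986, §4.12 (4.12.2), consequence] -/
theorem norm_Gamma_le_exp {x y : ℝ} (h0 : 0 < x) (h2 : x ≤ 1) (hy : 1 ≤ |y|) :
    ‖Complex.Gamma (x + y * I)‖ ≤ 16 * π ^ 2 * (1 + |y|) ^ (1 / 2 : ℝ) * Real.exp (-(π * |y|) / 2) := by
  have hπ := Real.pi_pos
  have hπ3 := Real.pi_gt_three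
  have hbase : 1 ≤ 1 + |y| := by linarith [abs_nonneg y]
  rcases le_or_gt (1 / 2) x with h1 | h1
  · refine (norm_Gamma_le_exp_of_half_le h1 h2 hy).trans ?_
    exact mul_le_mul_of_nonneg_right (mul_le_mul_of_nonneg_left
      (Real.rpow_le_rpow_of_exponent_le hbase (by linarith)) (by positivity)) (Real.exp_pos _).le
  · -- reflection
    set z : ℂ := x + y * I with hz
    have hrefl := Complex.Gamma_mul_Gamma_one_sub z
    have h1z : 1 - z = ((1 - x : ℝ) : ℂ) + (-y : ℝ) * I := by rw [hz]; push_cast; ring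
    have hlow : 4 / 15 * Real.exp (-(π * |y|) / 2) ≤ ‖Complex.Gamma (1 - z)‖ := by
      rw [h1z]
      have h := norm_Gamma_ge_Gamma_mul_exp (x := 1 - x) (by linarith) (by linarith) (-y)
      have hG := Gamma_ge_four_div_fifteen (x := 1 - x) (by linarith) (by linarith)
      rw [abs_neg] at h
      have hE := Real.exp_pos (-(π * |y|) / 2)
      nlinarith
    have hsin : Real.exp (π * |y|) / 4 ≤ ‖Complex.sin (π * z)‖ := by
      have h := abs_sinh_im_le_norm_sin (π * z)
      have him : (π * z).im = π * y := by rw [hz]; simp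
      rw [him, Real.abs_sinh, abs_mul, abs_of_pos hπ] at h
      have hs := exp_le_four_mul_sinh (u := π * |y|) (by nlinarith)
      linarith
    have hsin0 : 0 < ‖Complex.sin (π * z)‖ := lt_of_lt_of_le (by positivity) hsin
    have hG1 : 0 < ‖Complex.Gamma (1 - z)‖ := lt_of_lt_of_le (by positivity) hlow
    -- `‖Γ z‖ ‖Γ(1−z)‖ ‖sin πz‖ = π`
    have hprod : ‖Complex.Gamma z‖ * ‖Complex.Gamma (1 - z)‖ * ‖Complex.sin (π * z)‖ = π := by
      have h := congrArg norm hrefl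
      rw [norm_mul, norm_div, Complex.norm_real, Real.norm_of_nonneg hπ.le] at h
      rw [h]
      field_simp
    -- hence `‖Γ z‖ = π / (‖Γ(1−z)‖ ‖sin πz‖) ≤ π / ((4/15) e^{-π|y|/2} · e^{π|y|}/4)`
    have hE : Real.exp (-(π * |y|) / 2) * Real.exp (π * |y|) = Real.exp (π * |y| / 2) := by
      rw [← Real.exp_add]; congr 1; ring
    have hE2 : Real.exp (π * |y| / 2) * Real.exp (-(π * |y|) / 2) = 1 := by
      rw [← Real.exp_add]; convert Real.exp_zero using 2; ring
    have hden : Real.exp (π * |y| / 2) / 15 ≤ ‖Complex.Gamma (1 - z)‖ * ‖Complex.sin (π * z)‖ := by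
      calc Real.exp (π * |y| / 2) / 15 = (4 / 15 * Real.exp (-(π * |y|) / 2)) * (Real.exp (π * |y|) / 4) := by
            rw [← hE]; ring
        _ ≤ ‖Complex.Gamma (1 - z)‖ * ‖Complex.sin (π * z)‖ :=
            mul_le_mul hlow hsin (by positivity) (norm_nonneg _)
    have hΓ : ‖Complex.Gamma z‖ ≤ 15 * π * Real.exp (-(π * |y|) / 2) := by
      have hd0 : 0 < ‖Complex.Gamma (1 - z)‖ * ‖Complex.sin (π * z)‖ := by positivity
      have : ‖Complex.Gamma z‖ = π / (‖Complex.Gamma (1 - z)‖ * ‖Complex.sin (π * z)‖) := by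
        rw [eq_div_iff hd0.ne', ← mul_assoc]; exact hprod
      rw [this, div_le_iff₀ hd0]
      calc π = 15 * π * Real.exp (-(π * |y|) / 2) * (Real.exp (π * |y| / 2) / 15) := by
            rw [show 15 * π * Real.exp (-(π * |y|) / 2) * (Real.exp (π * |y| / 2) / 15) =
              π * (Real.exp (π * |y| / 2) * Real.exp (-(π * |y|) / 2)) by ring, hE2, mul_one]
        _ ≤ 15 * π * Real.exp (-(π * |y|) / 2) * (‖Complex.Gamma (1 - z)‖ * ‖Complex.sin (π * z)‖) := by
            gcongr
    refine hΓ.trans ?_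
    have hr : (1 : ℝ) ≤ (1 + |y|) ^ (1 / 2 : ℝ) := Real.one_le_rpow hbase (by norm_num)
    have hE0 := Real.exp_pos (-(π * |y|) / 2)
    calc 15 * π * Real.exp (-(π * |y|) / 2) ≤ 16 * π ^ 2 * 1 * Real.exp (-(π * |y|) / 2) := by
          apply mul_le_mul_of_nonneg_right _ hE0.le
          nlinarith
      _ ≤ 16 * π ^ 2 * (1 + |y|) ^ (1 / 2 : ℝ) * Real.exp (-(π * |y|) / 2) := by gcongr

/-- The upper bound on `0 < x ≤ 2`, `|y| ≥ 1`: `‖Γ(x + iy)‖ ≤ 16π² (1+|y|)^{3/2} e^{−π|y|/2}`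
(recurrence `Γ(z+1) = zΓ(z)`, `|z| ≤ 1 + |y|`). [cite: Titchmarsh1986, §4.12 (4.12.2), consequence] -/
theorem norm_Gamma_le_exp_of_le_two {x y : ℝ} (h0 : 0 < x) (h2 : x ≤ 2) (hy : 1 ≤ |y|) :
    ‖Complex.Gamma (x + y * I)‖ ≤ 16 * π ^ 2 * (1 + |y|) ^ (3 / 2 : ℝ) * Real.exp (-(π * |y|) / 2) := by
  have hbase : 1 ≤ 1 + |y| := by linarith [abs_nonneg y]
  have hpow : (1 + |y|) ^ (3 / 2 : ℝ) = (1 + |y|) * (1 + |y|) ^ (1 / 2 : ℝ) := by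
    rw [show (3 / 2 : ℝ) = 1 + 1 / 2 by norm_num, Real.rpow_add (by linarith), Real.rpow_one]
  rcases le_or_gt x 1 with h1 | h1
  · refine (norm_Gamma_le_exp h0 h1 hy).trans ?_
    rw [hpow]
    have hr : 0 ≤ (1 + |y|) ^ (1 / 2 : ℝ) := by positivity
    have hE0 := Real.exp_pos (-(π * |y|) / 2)
    have : (1 + |y|) ^ (1 / 2 : ℝ) ≤ (1 + |y|) * (1 + |y|) ^ (1 / 2 : ℝ) :=
      le_mul_of_one_le_left hr hbase
    gcongr
  · have hz : ((x - 1 : ℝ) : ℂ) + y * I ≠ 0 := by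
      intro h; have := congrArg Complex.re h; simp at this; linarith
    have hrec : Complex.Gamma (x + y * I) = (((x - 1 : ℝ) : ℂ) + y * I) *
        Complex.Gamma (((x - 1 : ℝ) : ℂ) + y * I) := by
      have e : ((x - 1 : ℝ) : ℂ) + y * I + 1 = x + y * I := by
        rw [Complex.ofReal_sub, Complex.ofReal_one]; ring
      rw [← e]; exact Complex.Gamma_add_one _ hz
    have hup := norm_Gamma_le_exp (x := x - 1) (by linarith) (by linarith) hy
    have hmod : ‖((x - 1 : ℝ) : ℂ) + y * I‖ ≤ 1 + |y| := by
      calc ‖((x - 1 : ℝ) : ℂ) + y * I‖ ≤ |((x - 1 : ℝ) : ℂ).re + 0| + |(((x - 1 : ℝ) : ℂ) + y * I).im| := by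
            have := Complex.norm_le_abs_re_add_abs_im (((x - 1 : ℝ) : ℂ) + y * I)
            simpa using this
        _ ≤ 1 + |y| := by
            simp only [Complex.ofReal_re, add_zero]
            have : |x - 1| ≤ 1 := by rw [abs_le]; constructor <;> linarith
            simp
            linarith
    rw [hrec, norm_mul, hpow]
    calc ‖((x - 1 : ℝ) : ℂ) + y * I‖ * ‖Complex.Gamma (((x - 1 : ℝ) : ℂ) + y * I)‖
        ≤ (1 + |y|) * (16 * π ^ 2 * (1 + |y|) ^ (1 / 2 : ℝ) * Real.exp (-(π * |y|) / 2)) :=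
          mul_le_mul hmod hup (norm_nonneg _) (by positivity)
      _ = 16 * π ^ 2 * ((1 + |y|) * (1 + |y|) ^ (1 / 2 : ℝ)) * Real.exp (-(π * |y|) / 2) := by ring

end Literature.Analysis.SpecialFunctions
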